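import Summits.Ventures.YMGap.Thresholds.SinglePlaquetteDiag
import Summits.Ventures.YMGap.Thresholds.LatticeBochner
import Literature.LinearAlgebra.Matrix.UnitaryDiagonalization
import HarnessLib

/-!
# Venture YMGap — THEOREM C, per-plaquette part: transported directions, the Hessian form `h_p`,
# the single-plaquette bound `h_p + γ̃_p ≤ 2Σ_{e∈p}|X_e|²` and the transport identity `γ̃_p = γ_p`

HONEST FRAMING: venture file (cell `pub-ymgap`, track (a), A2 = "Theorem C" of `p2/HESSIAN-SHARP.md`,
referee-checked in the cell). This file ASSEMBLES the kernel-checked bricks (`HessianRootSector`,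
`SinglePlaquetteDiag`, `LatticeBochner`) into the inequality of HESSIAN-SHARP §3,

  `H_Q(X,X) := Σ_{p : Plaquette d L} h_p(Q,X) ≤ 4d · |X|²`

on the torus `(ℤ/Lℤ)^d`, for link variables `Q_e ∈ M_N(ℂ)` with `Q_eᴴQ_e = 1` and anti-Hermitian
directions `X_e` — HYPOTHESIS-FREE (`hessianTotal_le_four_d'`): the unitary diagonalisability of
the plaquette holonomies needed by the single-plaquette lemma is the tree's
`Literature.LinearAlgebra.Matrix.exists_unitary_diagonalization` (spectral theorem for unitary
matrices); `hessianTotal_le_four_d` is the same statement with that input as an explicit hypothesis. `h_p` is the algebraic Hessian form (0.1) of HESSIAN-SHARP in the transported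
variables `Ỹ` (its identification with `∂²_t Re tr(e^{tX}Q)_p` — T2.1 — is not part of this file),
so the theorem here is exactly «Λ_d(N) ≤ 4d» of the cell's Theorem C at the level of the quadratic
form; the Bakry–Émery consequences (SZZ for `|β| < 1/(8d)`) need in addition the product-group
Bakry–Émery theorem (T2.2, a named printed fact). No threshold is claimed here.

Proof (HESSIAN-SHARP §3): per plaquette, SPL (`spl_of_unitary_conj_diagonal`) gives
`h_p + γ̃_p ≤ 2Σ_{e∈p}|X_e|²` with `γ̃_p = 2Re tr[Ỹ₁Ỹ₂+Ỹ₂Ỹ₃+Ỹ₃Ỹ₄+Ỹ₁WᴴỸ₄W]`; the transport identity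
(1.2) `γ̃_p = γ_p` (corner form, `gammaTilde_eq_gammaCorner`); `Σ_p Σ_{e∈p}|X_e|² = 2(d-1)|X|²`;
and Cor. 1 `Σ_p γ_p ≥ -4|X|²` (`LatticeBochner`). Hence `Σ_p h_p ≤ 4(d-1)|X|² + 4|X|² = 4d|X|²`.

References: `p2/HESSIAN-SHARP.md` §0–§3; `p2/LEAN-TARGETS-A2.md` T1.1, T1.2, T1.4; `HOME/lean/A2-PORT-SCOPE.md`.
-/

noncomputable section

namespace Summit.Ventures.YMGap.HessianSharp

open ComplexConjugate Complex Matrix Finset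
open Literature.MathematicalPhysics.QuantumFieldTheory (Site Edge Plaquette)

variable {N d L : ℕ}

/-! ### Plaquette data: links, holonomy, transported directions -/

section PlaquetteData

variable (Q X : Edge d L → Matrix (Fin N) (Fin N) ℂ) (x : Site d L) (μ ν : Fin d)

/-- The four links of the plaquette `(x; μ, ν)` are `e₁ = (x,μ)`, `e₂ = (x+e_μ,ν)`, `e₃ = (x+e_ν,μ)`,
`e₄ = (x,ν)` (HESSIAN-SHARP §0; the tree's `plaquetteHolonomy` ordering); `link2`, `link3` name the
two shifted ones. -/
def link2 : Edge d L := (x + unitVec μ, ν)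
/-- `e₃ = (x+e_ν, μ)`. -/
def link3 : Edge d L := (x + unitVec ν, μ)

/-- The holonomy `W = Q₁Q₂Q₃ᴴQ₄ᴴ` (for unitary links `Qᴴ = Q⁻¹`, so this is the tree's
`plaquetteHolonomy`). -/
def hol : Matrix (Fin N) (Fin N) ℂ :=
  Q (x, μ) * Q (link2 x μ ν) * (Q (link3 x μ ν))ᴴ * (Q (x, ν))ᴴ

/-- The partial transport `P₃ = Q₁Q₂Q₃ᴴ`. -/
def hol3 : Matrix (Fin N) (Fin N) ℂ := Q (x, μ) * Q (link2 x μ ν) * (Q (link3 x μ ν))ᴴ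

/-- **The transported directions** `Ỹ₁ = X₁`, `Ỹ₂ = Ad(Q₁)X₂`, `Ỹ₃ = -Ad(Q₁Q₂Q₃⁻¹)X₃`,
`Ỹ₄ = -Ad(W)X₄` (HESSIAN-SHARP §0, SZZ (4.3) bookkeeping). -/
def yTilde : Fin 4 → Matrix (Fin N) (Fin N) ℂ :=
  ![X (x, μ),
    Q (x, μ) * X (link2 x μ ν) * (Q (x, μ))ᴴ,
    -(hol3 Q x μ ν * X (link3 x μ ν) * (hol3 Q x μ ν)ᴴ),
    -(hol Q x μ ν * X (x, ν) * (hol Q x μ ν)ᴴ)]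

/-- **The Hessian form of one plaquette** (HESSIAN-SHARP (0.1)):
`h_p(Q,X) = Σ_i Re tr(Ỹ_i² W) + 2 Σ_{i<j} Re tr(Ỹ_i Ỹ_j W)`. -/
def hessForm : ℝ :=
  ((yTilde Q X x μ ν 0 * yTilde Q X x μ ν 0 * hol Q x μ ν).trace +
      (yTilde Q X x μ ν 1 * yTilde Q X x μ ν 1 * hol Q x μ ν).trace +
      (yTilde Q X x μ ν 2 * yTilde Q X x μ ν 2 * hol Q x μ ν).trace +
      (yTilde Q X x μ ν 3 * yTilde Q X x μ ν 3 * hol Q x μ ν).trace +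
    2 * ((yTilde Q X x μ ν 0 * yTilde Q X x μ ν 1 * hol Q x μ ν).trace +
      (yTilde Q X x μ ν 0 * yTilde Q X x μ ν 2 * hol Q x μ ν).trace +
      (yTilde Q X x μ ν 0 * yTilde Q X x μ ν 3 * hol Q x μ ν).trace +
      (yTilde Q X x μ ν 1 * yTilde Q X x μ ν 2 * hol Q x μ ν).trace +
      (yTilde Q X x μ ν 1 * yTilde Q X x μ ν 3 * hol Q x μ ν).trace +
      (yTilde Q X x μ ν 2 * yTilde Q X x μ ν 3 * hol Q x μ ν).trace)).re

/-- `γ̃_p = 2 Re tr[Ỹ₁Ỹ₂ + Ỹ₂Ỹ₃ + Ỹ₃Ỹ₄ + Ỹ₁WᴴỸ₄W]` (HESSIAN-SHARP (1.2), right side). -/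
def gammaTilde : ℝ :=
  (2 * ((yTilde Q X x μ ν 0 * yTilde Q X x μ ν 1).trace +
      (yTilde Q X x μ ν 1 * yTilde Q X x μ ν 2).trace +
      (yTilde Q X x μ ν 2 * yTilde Q X x μ ν 3).trace +
      (yTilde Q X x μ ν 0 * (hol Q x μ ν)ᴴ * yTilde Q X x μ ν 3 * hol Q x μ ν).trace)).re

/-- `h_p + γ̃_p` is the left side of SPL at `(W, Ỹ)`. -/
theorem hessForm_add_gammaTilde :
    hessForm Q X x μ ν + gammaTilde Q X x μ ν = splLHS (hol Q x μ ν) (yTilde Q X x μ ν) := by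
  simp only [hessForm, gammaTilde, splLHS, ← Complex.add_re]

end PlaquetteData

/-- A matrix is unitarily diagonalisable with unimodular spectrum: `W = g · diag(e^{iθ}) · gᴴ`,
`gᴴg = 1`. True for every unitary matrix (spectral theorem for normal matrices; not in the pinned
Mathlib) — used below as an explicit HYPOTHESIS, never asserted. -/
def UnitarilyDiagonalizable (W : Matrix (Fin N) (Fin N) ℂ) : Prop :=
  ∃ (g : Matrix (Fin N) (Fin N) ℂ) (θ : Fin N → ℝ),
    gᴴ * g = 1 ∧ W = g * (diagonal fun a => exp (θ a * I)) * gᴴ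

/-! ### Small matrix facts -/

section MatrixFacts

/-- `frobNormSq` of `SinglePlaquetteDiag` is `nsq` of `LatticeBochner`. -/
private theorem frobNormSq_eq_nsq (A : Matrix (Fin N) (Fin N) ℂ) : frobNormSq A = nsq A := by
  rw [nsq_eq_sum_normSq]; rfl

/-- `|gXgᴴ|² = |X|²` for `gᴴg = 1` (in `nsq` form). -/
private theorem nsq_conj {g : Matrix (Fin N) (Fin N) ℂ} (hg : gᴴ * g = 1) (A : Matrix (Fin N) (Fin N) ℂ) :
    nsq (g * A * gᴴ) = nsq A := by
  rw [← frobNormSq_eq_nsq, ← frobNormSq_eq_nsq, frobNormSq_conj hg]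

/-- Products of unitaries are unitary. -/
private theorem unitary_mul {A B : Matrix (Fin N) (Fin N) ℂ} (hA : Aᴴ * A = 1) (hB : Bᴴ * B = 1) :
    (A * B)ᴴ * (A * B) = 1 := by
  rw [conjTranspose_mul]
  calc Bᴴ * Aᴴ * (A * B) = Bᴴ * (Aᴴ * A) * B := by simp only [Matrix.mul_assoc]
    _ = 1 := by rw [hA, Matrix.mul_one, hB]

/-- The adjoint of a unitary is unitary. -/
private theorem unitary_conjTranspose {A : Matrix (Fin N) (Fin N) ℂ} (hA : Aᴴ * A = 1) : Aᴴᴴ * Aᴴ = 1 := by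
  rw [conjTranspose_conjTranspose]
  exact mul_eq_one_comm.1 hA

/-- Conjugation preserves anti-Hermiticity. -/
private theorem conj_antiHermitian {X : Matrix (Fin N) (Fin N) ℂ} (hX : Xᴴ = -X) (g : Matrix (Fin N) (Fin N) ℂ) :
    (g * X * gᴴ)ᴴ = -(g * X * gᴴ) := by
  rw [conjTranspose_mul, conjTranspose_mul, conjTranspose_conjTranspose, hX]
  simp only [Matrix.mul_neg, Matrix.neg_mul, Matrix.mul_assoc]

end MatrixFacts

/-! ### Per plaquette: SPL and the transport identity (1.2) -/

section PerPlaquette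

variable (Q X : Edge d L → Matrix (Fin N) (Fin N) ℂ)
variable (hQ : ∀ e, (Q e)ᴴ * Q e = 1) (hX : ∀ e, (X e)ᴴ = -X e)

include hQ in
/-- The holonomy is unitary. -/
theorem hol_unitary (x : Site d L) (μ ν : Fin d) : (hol Q x μ ν)ᴴ * hol Q x μ ν = 1 := by
  unfold hol
  exact unitary_mul (unitary_mul (unitary_mul (hQ _) (hQ _)) (unitary_conjTranspose (hQ _)))
    (unitary_conjTranspose (hQ _))

include hQ in
/-- The partial transport is unitary. -/
theorem hol3_unitary (x : Site d L) (μ ν : Fin d) : (hol3 Q x μ ν)ᴴ * hol3 Q x μ ν = 1 := by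
  unfold hol3
  exact unitary_mul (unitary_mul (hQ _) (hQ _)) (unitary_conjTranspose (hQ _))

include hX in
/-- The transported directions are anti-Hermitian. -/
theorem yTilde_antiHermitian (x : Site d L) (μ ν : Fin d) (i : Fin 4) :
    (yTilde Q X x μ ν i)ᴴ = -yTilde Q X x μ ν i := by
  fin_cases i
  · exact hX _
  · exact conj_antiHermitian (hX _) _
  · simp only [yTilde, Fin.reduceFinMk, Matrix.cons_val]
    rw [conjTranspose_neg, conj_antiHermitian (hX _)]
  · simp only [yTilde, Fin.reduceFinMk, Matrix.cons_val]
    rw [conjTranspose_neg, conj_antiHermitian (hX _)]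

include hQ in
/-- Transport is an isometry: `Σ_i |Ỹ_i|² = Σ_{e∈p} |X_e|²`. -/
theorem sum_frobNormSq_yTilde (x : Site d L) (μ ν : Fin d) :
    ∑ i, frobNormSq (yTilde Q X x μ ν i) =
      nsq (X (x, μ)) + nsq (X (link2 x μ ν)) + nsq (X (link3 x μ ν)) + nsq (X (x, ν)) := by
  simp only [Fin.sum_univ_four, frobNormSq_eq_nsq, yTilde, Matrix.cons_val_zero, Matrix.cons_val_one,
    Matrix.head_cons, Matrix.cons_val_two, Matrix.tail_cons, Matrix.cons_val_three, nsq_neg]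
  rw [nsq_conj (hQ _), nsq_conj (hol3_unitary Q hQ x μ ν), nsq_conj (hol_unitary Q hQ x μ ν)]

include hQ hX in
/-- **SPL for one plaquette**: `h_p + γ̃_p ≤ 2 Σ_{e∈p}|X_e|²`, given a unitary diagonalisation of the
holonomy. -/
theorem hessForm_add_gammaTilde_le (x : Site d L) (μ ν : Fin d)
    (hW : UnitarilyDiagonalizable (hol Q x μ ν)) :
    hessForm Q X x μ ν + gammaTilde Q X x μ ν ≤
      2 * (nsq (X (x, μ)) + nsq (X (link2 x μ ν)) + nsq (X (link3 x μ ν)) +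
        nsq (X (x, ν))) := by
  obtain ⟨g, θ, hg, hWeq⟩ := hW
  rw [hessForm_add_gammaTilde, ← sum_frobNormSq_yTilde Q X hQ, hWeq]
  exact spl_of_unitary_conj_diagonal g hg θ _ (yTilde_antiHermitian Q X hX x μ ν)

/-- Vertex arithmetic on the torus: `(x + e_μ) - e_μ = x`. -/
private theorem add_unitVec_sub (x : Site d L) (μ : Fin d) : x + unitVec μ - unitVec μ = x :=
  add_sub_cancel_right x _

/-- `(x + e_μ + e_ν) - e_ν = x + e_μ`. -/
private theorem add_add_unitVec_sub_right (x : Site d L) (μ ν : Fin d) :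
    x + unitVec μ + unitVec ν - unitVec ν = x + unitVec μ := add_sub_cancel_right _ _

/-- `(x + e_μ + e_ν) - e_μ = x + e_ν`. -/
private theorem add_add_unitVec_sub_left (x : Site d L) (μ ν : Fin d) :
    x + unitVec μ + unitVec ν - unitVec μ = x + unitVec ν := by
  rw [add_assoc, add_comm (unitVec μ), ← add_assoc, add_sub_cancel_right]

include hQ hX in
/-- **The transport identity (1.2)**: `γ̃_p = γ_p` — the `Ỹ`-form of HESSIAN-SHARP (1.2) equals the
corner form (1.1) (`LatticeBochner.gammaCorner`). Uses only `QᴴQ = QQᴴ = 1`, `Xᴴ = -X` and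
cyclicity of the trace. -/
theorem gammaTilde_eq_gammaCorner (x : Site d L) (μ ν : Fin d) :
    gammaTilde Q X x μ ν = gammaCorner Q X x μ ν := by
  -- names
  set Q1 := Q (x, μ) with hQ1
  set Q2 := Q (link2 x μ ν) with hQ2
  set Q3 := Q (link3 x μ ν) with hQ3
  set Q4 := Q (x, ν) with hQ4
  set X1 := X (x, μ) with hX1
  set X2 := X (link2 x μ ν) with hX2
  set X3 := X (link3 x μ ν) with hX3
  set X4 := X (x, ν) with hX4
  have u1 : Q1ᴴ * Q1 = 1 := hQ _
  have u2 : Q2ᴴ * Q2 = 1 := hQ _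
  have u3 : Q3ᴴ * Q3 = 1 := hQ _
  have u4 : Q4ᴴ * Q4 = 1 := hQ _
  have u1' : Q1 * Q1ᴴ = 1 := mul_eq_one_comm.1 u1
  have u2' : Q2 * Q2ᴴ = 1 := mul_eq_one_comm.1 u2
  have u3' : Q3 * Q3ᴴ = 1 := mul_eq_one_comm.1 u3
  have u4' : Q4 * Q4ᴴ = 1 := mul_eq_one_comm.1 u4
  have a1 : X1ᴴ = -X1 := hX _
  have a2 : X2ᴴ = -X2 := hX _
  have a3 : X3ᴴ = -X3 := hX _
  have a4 : X4ᴴ = -X4 := hX _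
  -- the corner transports
  have m1 : xMinus Q X (x + unitVec μ) μ = -(Q1ᴴ * X1 * Q1) := by
    simp only [xMinus, add_unitVec_sub, hQ1, hX1]
  have m2 : xMinus Q X (x + unitVec μ + unitVec ν) ν = -(Q2ᴴ * X2 * Q2) := by
    simp only [xMinus, add_add_unitVec_sub_right, hQ2, hX2, link2]
  have m3 : xMinus Q X (x + unitVec μ + unitVec ν) μ = -(Q3ᴴ * X3 * Q3) := by
    simp only [xMinus, add_add_unitVec_sub_left, hQ3, hX3, link3]
  have m4 : xMinus Q X (x + unitVec ν) ν = -(Q4ᴴ * X4 * Q4) := by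
    simp only [xMinus, add_unitVec_sub, hQ4, hX4]
  -- holonomy bookkeeping
  set W := hol Q x μ ν with hW
  set P3 := hol3 Q x μ ν with hP3
  have hWdef : W = Q1 * Q2 * Q3ᴴ * Q4ᴴ := rfl
  have hP3def : P3 = Q1 * Q2 * Q3ᴴ := rfl
  have uW : Wᴴ * W = 1 := hol_unitary Q hQ x μ ν
  have uW' : W * Wᴴ = 1 := mul_eq_one_comm.1 uW
  -- P₃ᴴ W = Q₄ᴴ and Wᴴ P₃ = Q₄
  have hP3W : P3ᴴ * W = Q4ᴴ := by
    rw [hP3def, hWdef, conjTranspose_mul, conjTranspose_mul, conjTranspose_conjTranspose]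
    calc Q3 * (Q2ᴴ * Q1ᴴ) * (Q1 * Q2 * Q3ᴴ * Q4ᴴ)
        = Q3 * (Q2ᴴ * (Q1ᴴ * Q1) * Q2) * Q3ᴴ * Q4ᴴ := by simp only [Matrix.mul_assoc]
      _ = Q4ᴴ := by rw [u1, Matrix.mul_one, u2, Matrix.mul_one, u3', Matrix.one_mul]
  have hWP3 : Wᴴ * P3 = Q4 := by
    have := congr_arg conjTranspose hP3W
    rwa [conjTranspose_mul, conjTranspose_conjTranspose, conjTranspose_conjTranspose] at this
  -- the shifted links, syntactically
  have l2 : X (x + unitVec μ, ν) = X2 := rfl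
  have l3 : X (x + unitVec ν, μ) = X3 := rfl
  -- unfold both sides
  simp only [gammaTilde, gammaCorner, yTilde, Matrix.cons_val_zero, Matrix.cons_val_one,
    Matrix.head_cons, Matrix.cons_val_two, Matrix.tail_cons, Matrix.cons_val_three, xPlus, m1, m2,
    m3, m4, ip, l2, l3]
  simp only [← hQ1, ← hX1, ← hX4, ← hW, ← hP3]
  -- term by term
  have tA : (X1 * Wᴴ * -(W * X4 * Wᴴ) * W).trace = -(X1 * X4).trace := by
    have : X1 * Wᴴ * -(W * X4 * Wᴴ) * W = -(X1 * (Wᴴ * W) * X4 * (Wᴴ * W)) := by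
      simp only [Matrix.mul_neg, Matrix.neg_mul, Matrix.mul_assoc]
    rw [this, uW, Matrix.mul_one, Matrix.mul_one, Matrix.trace_neg]
  have tB : (X1 * (Q1 * X2 * Q1ᴴ)).trace = (Q1ᴴ * X1 * Q1 * X2).trace := by
    rw [show X1 * (Q1 * X2 * Q1ᴴ) = (X1 * Q1 * X2) * Q1ᴴ by simp only [Matrix.mul_assoc],
      Matrix.trace_mul_comm]
    simp only [Matrix.mul_assoc]
  have tC : (Q1 * X2 * Q1ᴴ * -(P3 * X3 * P3ᴴ)).trace = -(Q2ᴴ * X2 * Q2 * (Q3ᴴ * X3 * Q3)).trace := by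
    have h1 : Q1 * X2 * Q1ᴴ * -(P3 * X3 * P3ᴴ) = -(Q1 * (X2 * Q2 * Q3ᴴ * X3 * Q3 * Q2ᴴ) * Q1ᴴ) := by
      rw [hP3def, conjTranspose_mul, conjTranspose_mul, conjTranspose_conjTranspose]
      calc Q1 * X2 * Q1ᴴ * -(Q1 * Q2 * Q3ᴴ * X3 * (Q3 * (Q2ᴴ * Q1ᴴ)))
          = -(Q1 * X2 * (Q1ᴴ * Q1) * Q2 * Q3ᴴ * X3 * Q3 * Q2ᴴ * Q1ᴴ) := by
            simp only [Matrix.mul_neg, Matrix.mul_assoc]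
        _ = -(Q1 * (X2 * Q2 * Q3ᴴ * X3 * Q3 * Q2ᴴ) * Q1ᴴ) := by
            rw [u1, Matrix.mul_one]; simp only [Matrix.mul_assoc]
    rw [h1, Matrix.trace_neg, trace_conj u1, Matrix.trace_mul_comm (X2 * Q2 * Q3ᴴ * X3 * Q3) Q2ᴴ]
    simp only [Matrix.mul_assoc]
  have tD : (-(P3 * X3 * P3ᴴ) * -(W * X4 * Wᴴ)).trace = (X3 * Q4ᴴ * X4 * Q4).trace := by
    rw [neg_mul_neg]
    have : P3 * X3 * P3ᴴ * (W * X4 * Wᴴ) = P3 * (X3 * (P3ᴴ * W) * X4 * Wᴴ) := by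
      simp only [Matrix.mul_assoc]
    rw [this, Matrix.trace_mul_comm, hP3W]
    have : X3 * Q4ᴴ * X4 * Wᴴ * P3 = X3 * Q4ᴴ * X4 * (Wᴴ * P3) := by simp only [Matrix.mul_assoc]
    rw [this, hWP3]
  rw [tA, tB, tC, tD]
  -- the corner side: conjugate transposes of the transported X's
  simp only [conjTranspose_neg, conjTranspose_mul, conjTranspose_conjTranspose, a2, a3, a4,
    Matrix.mul_neg, Matrix.neg_mul, neg_neg, Matrix.trace_neg, Complex.neg_re]
  have e3 : (Q2ᴴ * X2 * Q2 * (Q3ᴴ * (X3 * Q3))).trace = (Q2ᴴ * X2 * Q2 * (Q3ᴴ * X3 * Q3)).trace := by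
    simp only [Matrix.mul_assoc]
  have e4 : (X3 * (Q4ᴴ * (X4 * Q4))).trace = (X3 * Q4ᴴ * X4 * Q4).trace := by
    simp only [Matrix.mul_assoc]
  rw [e3, e4]
  simp only [Complex.add_re, Complex.neg_re, Complex.mul_re, Complex.re_ofNat,
    Complex.im_ofNat, zero_mul, sub_zero]
  ring

end PerPlaquette

end Summit.Ventures.YMGap.HessianSharp
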